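import Literature.NumberTheory.Automorphic.ResGLnCuspidalCohomologyApexBasic
import Literature.NumberTheory.Automorphic.ResGLnKugaHarmonic
import Summits.Langlands.Langlands.Theorems.IrreducibilityBySelfDualityHeckeEigenvalueFieldStubTupleD
import HarnessLib

/-!
# The differential of the tuple model of `C^•(𝔤, K'; W ⊗ E_λ)^{K_∞, K(𝔫)}` —
crux HeckeEigenvalueField (stmt-Langlands-13632), line Sketch, stub END-DT

Statement.  Let `π` be a cuspidal automorphic representation datum of `GL_n(𝔸_K)`, `E_λ` the
archimedean coefficient module and `τ ∈ C^q(𝔤; W ⊗ E_λ)` a cochain which (1) lies in the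
`(𝔤, K_∞)`-complex `gkComplexLS π S λ`, (2) is relative for `K' = 𝔨 ⊕ ℝ·1` and (3) has
`K(𝔫)`-fixed values.  Then `dτ` has the same three properties, and on tuples of the orthonormal
basis `x` of `𝔭₀`
`(dτ)(x_{I 0}, …, x_{I q}) = ∑ᵢ (-1)ⁱ x_{I i} · τ(…, x̂_{I i}, …)`,
where `X · (w ⊗ e) = Xw ⊗ e + w ⊗ dE(X) e` is the Leibniz action
[cite: BorelWallach2000, I §1.1 (2) and I §5.1].

Proof.  (1) and (2): the `(𝔤, K_∞)`-complex and the relative complex of `K'` are subcomplexes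
(`Subcomplex.d_mem`).  (3): right translations `r(u) ⊗ 1`, `u ∈ K(𝔫)`, commute with the Leibniz
action, so `d` commutes with the cochain maps `(r(u) ⊗ 1)_*` (the tree's
`ConeDictionary.IsLevelFixed.d`).  The tuple formula is the landed stub TUPLE-D
(`stub_d_apply_basisTuple`) for the Lie subalgebra `K'`, the family `x` (`⁅x_i, x_j⁆ ∈ K'`,
`kugaD_hxx`) and the `K'`-horizontal cochain `τ` (relative cochains are horizontal), read through the
identification of the carrier `W ⊗ E_λ` with its type synonym (real scalars are restricted complex
scalars, the bracket is the Leibniz action).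

## References

* A. Borel, N. Wallach, *Continuous cohomology, discrete subgroups, and representations of
  reductive groups*, 2nd ed., Math. Surveys Monogr. 67 (2000), I §1.1 (2), I §1.2, I §5.1.
  [BorelWallach2000]
* C. Chevalley, S. Eilenberg, *Cohomology theory of Lie groups and Lie algebras*, Trans. Amer.
  Math. Soc. 63 (1948) 85–124, §23, §28. [ChevalleyEilenberg1948]
-/

set_option linter.dupNamespace false -- project-wide: `Summit.Langlands.Langlands` is the mandated namespace

-- `Classical`: the place subtypes indexing `mixedSpace K` are `Fintype` classically (as in the tree)
open scoped TensorProduct Classical Matrix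
open NumberField NumberField.mixedEmbedding Literature.NumberTheory.Automorphic
open Literature.Algebra.Lie Literature.Algebra.Lie.ChevalleyEilenberg

namespace Summit.Langlands.Langlands.Theorems.HeckeEigenvalueField.Res

set_option maxHeartbeats 400000 in
-- the registered statement is a tower of reducible re-typings over the datum (heavy to elaborate)
/-- **Stub END-DT — the differential of the tuple model.**  `d` preserves the level-`𝔫`, `K'`-relative
`(𝔤, K_∞)`-cochains (subcomplexes; `r(u) ⊗ 1` commutes with the Leibniz action), and on `xD`-tuples of such
a cochain `(dτ)(x ∘ I) = ∑ᵢ (-1)ⁱ x_{I i} · τ(x ∘ I ∘ σᵢ)` (landed TUPLE-D `stub_d_apply_basisTuple` with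
`K = K'`, `[x_i, x_j] ∈ K'` = `kugaD_hxx`). [cite: BorelWallach2000, I §1.1 and §5.1] -/
theorem stub_end_dt {n : ℕ} {K : Type} [Field K] [NumberField K]
    (hcpt : isCompact_glFiniteIntegralLevel n K) (𝔫 : Ideal (𝓞 K))
    (π : CuspidalAutomorphicRepData n K hcpt)
    (S : Finset {w : InfinitePlace K // w.IsReal}) (lam : (K →+* ℂ) → Fin n → ℤ) {q : ℕ}
    (τ : ConeDictionary.Cochain π.1 lam q) :
    (τ ∈ (ConeDictionary.gkComplexLS π.1 S lam).carrier q) →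
      (τ ∈ (Subcomplex.rel ℝ (ConeDictionary.𝔤D n K hcpt) (ConeDictionary.Carrier π.1 lam)
        (ConeDictionary.kPrimeD n K hcpt)).carrier q) →
      ConeDictionary.IsLevelFixed π.1 lam 𝔫 τ →
    ((d ℝ (ConeDictionary.𝔤D n K hcpt) (ConeDictionary.Carrier π.1 lam) q τ ∈
        (ConeDictionary.gkComplexLS π.1 S lam).carrier (q + 1)) ∧
      (d ℝ (ConeDictionary.𝔤D n K hcpt) (ConeDictionary.Carrier π.1 lam) q τ ∈
        (Subcomplex.rel ℝ (ConeDictionary.𝔤D n K hcpt) (ConeDictionary.Carrier π.1 lam)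
          (ConeDictionary.kPrimeD n K hcpt)).carrier (q + 1)) ∧
      ConeDictionary.IsLevelFixed π.1 lam 𝔫 (d ℝ (ConeDictionary.𝔤D n K hcpt) (ConeDictionary.Carrier π.1 lam) q τ)) ∧
    ∀ I : Fin (q + 1) → Fin (ResGLnCartan.pZeroDim n K),
      @id (π.1.W ⊗[ℂ] ResGLnCohomology.CoeffModule ℂ n K lam)
          (d ℝ (ConeDictionary.𝔤D n K hcpt) (ConeDictionary.Carrier π.1 lam) q τ
            (fun i => ConeDictionary.xD n K hcpt (I i))) =
        ∑ i : Fin (q + 1), ((-1 : ℂ) ^ (i : ℕ)) •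
          GKTensor.lie (AutomorphyDatum.gl n K hcpt).arch π.1.lieRepW (ConeDictionary.σ𝔤S hcpt lam)
            (ConeDictionary.xD n K hcpt (I i))
            (@id (π.1.W ⊗[ℂ] ResGLnCohomology.CoeffModule ℂ n K lam) (τ (fun j => ConeDictionary.xD n K hcpt (I (i.succAbove j))))) := by
  intro h1 h2 h3
  -- (2) unfolded: relative cochains of `K'` are `K'`-horizontal
  have hτh : τ ∈ horizontal (ConeDictionary.kPrimeD n K hcpt) q := (Submodule.mem_inf.1 h2).2
  refine ⟨⟨(ConeDictionary.gkComplexLS π.1 S lam).d_mem q τ h1,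
    (Subcomplex.rel ℝ (ConeDictionary.𝔤D n K hcpt) (ConeDictionary.Carrier π.1 lam)
      (ConeDictionary.kPrimeD n K hcpt)).d_mem q τ h2, h3.d⟩, fun I => ?_⟩
  -- the tuple formula in the `𝔤`-module `Carrier π λ` (real scalars, bracket = Leibniz action)
  have e := stub_d_apply_basisTuple (ConeDictionary.kPrimeD n K hcpt) (ConeDictionary.xD n K hcpt)
    (ConeDictionary.kugaD_hxx n K hcpt) τ hτh I
  change d ℝ (ConeDictionary.𝔤D n K hcpt) (ConeDictionary.Carrier π.1 lam) q τ
      (fun i => ConeDictionary.xD n K hcpt (I i)) = _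
  rw [e]
  refine Finset.sum_congr rfl fun i _ => ?_
  rw [ConeDictionary.carrier_smul_eq, Complex.ofReal_pow, Complex.ofReal_neg, Complex.ofReal_one]
  rfl

end Summit.Langlands.Langlands.Theorems.HeckeEigenvalueField.Res
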